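import Literature.Probability.Percolation.ArmSeparationOutArith
import Literature.Probability.Percolation.ArmSeparationExtSlotEvents
import Literature.Probability.Percolation.ArmSeparationSlotProb
import HarnessLib

/-!
# Outer slot events: monotonicity, supports, and the probability of the corridors

Topic: Probability / Percolation; family `crit-perc` (`P = P_{1/2} = triSitePercolation half`). A
brick of the discharge of `Literature.Probability.Percolation.Nolin2008_twoArm_separation`
(Nolin 2008, Thm. 11 [arXiv 0711.4948: Thm. 10], `j = 2`, `σ = BW`; `ArmSeparation.lean`), landing
step of the external extremities (Nolin 2008, Prop. 12 [arXiv Prop. 11], §4.4 p. 12, whose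
probabilistic engine is Lemma 13 [arXiv Lemma 12]: the generalised FKG inequality for events
`A⁺, Ã⁺` increasing and `A⁻, Ã⁻` decreasing on disjoint finite supports). For an outer slot `σ`
(`ArmSeparationOutSlots.lean`) the four events are `A⁺ = oblackArm σ`, `A⁻ = owhiteArm σ`,
`Ã⁺ = oblackCorr σ`, `Ã⁻ = owhiteCorr σ`; this file (the outward twin of
`ArmSeparationSlotEvents.lean` and `ArmSeparationSlotProb.lean`) proves their monotonicity,
exhibits finite supports — the **shared support** `osharedFin n M = {n ≤ |v| ≤ 2M}` (the annulus
of the arms, including the trapezoids of the protections), the **private supports** `Slot.oPfin`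
(`frameIso io` of the outer slot frame box and of the outer spoke, the arc, the approach and target
boxes) and `Slot.oMfin` (the reflection of the same for the closed arm) — and bounds the
probability of the corridors from below: the outer corridor event of one colour (beacon, outer
spoke, arc of a thin ring, approach tube, target free space on `∂Λ_{N'}`) is an intersection of
finitely many increasing box-crossing events of bounded aspect ratio, so by RSW (`tri_rsw_half`)
and Harris its probability is at least `c_F · c_ρ^(len+3)` (`real_ocorrEvent_ge`), and the
corridor of the closed arm has the same bound by the `negFlip`-invariance of `P_{1/2}`
(`Slot.real_owhiteCorr_eq`, `Slot.real_ocorr_ge`).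

* `TrapFencedArm.congr'` (next to `trapTipOK_mono/congr`, `TrapFencedArm.mapMono` of
  `ArmSeparationExtSlotEvents.lean`);
* `isUpperSet_oblackArm`, `isLowerSet_owhiteArm`, `isUpperSet_ocorrEvent`, `isLowerSet_owhiteCorr`;
* `oslotFrame`, `osharedFin`, `ocorrFin`, `Slot.oPfin`, `Slot.oMfin`;
* `determinedBy_ocorrEvent`, `determinedBy_oblackCorr`, `determinedBy_owhiteCorr`,
  `determinedBy_oblackArm`, `determinedBy_owhiteArm`;
* `real_ocorrEvent_ge`, `Slot.real_owhiteCorr_eq`, `Slot.real_ocorr_ge`.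

## References

* P. Nolin, *Near-critical percolation in two dimensions*, Electron. J. Probab. 13 (2008), §4.3
  Prop. 12, Lemma 13, §4.4 [arXiv 0711.4948: Prop. 11, Lemma 12, Thm. 10, p. 12 (constants
  `C₁, C₂`)]. [Nolin2008]
* H. Kesten, *Scaling relations for 2D-percolation*, Comm. Math. Phys. 109 (1987), Lemma 2, §2. [Kesten1987]
-/

noncomputable section

open Set MeasureTheory

namespace Literature.Probability.Percolation

open LatticeModels Tube

/-! ### Transport of fenced outer tips -/

-- `trapTipOK_mono`, `trapTipOK_congr`, `TrapFencedArm.mapMono` are in `ArmSeparationExtSlotEvents.lean`.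

namespace TrapFencedArm

variable {M n k₀ K : ℕ} {χ χ' : SiteConfig (Site 2)}

/-- **A fenced outer arm is a property of the configuration on the annulus `{n ≤ |v| ≤ 2M}`, its fence
zone and its fence strip** (`n ≤ M`). [folklore] -/
def congr' (hnM : n ≤ M) (F : TrapFencedArm M n k₀ K χ)
    (h : ∀ v ∈ triAnnSet n (2 * M) ∪ trapFrameZone M F.z F.k ∪ triStrip (F.z 0 + F.k) (F.z 1 + F.k) F.k F.k, v ∈ χ ↔ v ∈ χ') :
    TrapFencedArm M n k₀ K χ' where
  z := F.z
  j := F.j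
  m := F.m
  a := F.a
  z_mem := F.z_mem
  j_lt := F.j_lt
  norm_a := F.norm_a
  tipOK := trapTipOK_congr (fun v hv => h v (hv.elim (fun hv => Or.inr hv) fun hv =>
    Or.inl (Or.inl (trapD_subset_triAnnSet hnM hv)))) F.tipOK
  path := F.path.mono fun v hv => ⟨hv.1, (h v (hv.1.elim (fun h' => Or.inl (Or.inl h')) fun h' => Or.inl (Or.inr h'))).1 hv.2⟩
  path_tip := F.path_tip.mono fun v hv => ⟨hv.1, (h v (Or.inl (Or.inl hv.1))).1 hv.2⟩

/-- `congr'` keeps the data. [folklore] -/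
@[simp] theorem congr'_data (hnM : n ≤ M) (F : TrapFencedArm M n k₀ K χ)
    (h : ∀ v ∈ triAnnSet n (2 * M) ∪ trapFrameZone M F.z F.k ∪ triStrip (F.z 0 + F.k) (F.z 1 + F.k) F.k F.k, v ∈ χ ↔ v ∈ χ') :
    (F.congr' hnM h).z = F.z ∧ (F.congr' hnM h).j = F.j ∧ (F.congr' hnM h).a = F.a := ⟨rfl, rfl, rfl⟩

end TrapFencedArm

/-! ### Monotonicity -/

namespace Slot

variable (P : OParams) (σ : Slot)

/-- **The tiny-fenced open outer arm event of a slot is increasing.** [folklore] -/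
theorem isUpperSet_oblackArm : IsUpperSet (σ.oblackArm P) := by
  intro ω ω' hle hω
  obtain ⟨Fo, hmid, hj, h1, h2⟩ := hω
  exact ⟨Fo.mapMono (frameConfig_mono σ.io hle), hmid, hj, h1, h2⟩

/-- **The tiny-fenced closed outer arm event of a slot is decreasing.** [folklore] -/
theorem isLowerSet_owhiteArm : IsLowerSet (σ.owhiteArm P) := by
  intro ω ω' hle hω
  obtain ⟨Fc, hmid, hj, h1, h2⟩ := hω
  have hle' : (frameConfig σ.ic ω)ᶜ ≤ (frameConfig σ.ic ω')ᶜ := Set.compl_subset_compl.2 (frameConfig_mono σ.ic hle)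
  exact ⟨Fc.mapMono hle', hmid, hj, h1, h2⟩

end Slot

/-- The outer beacon event is increasing. [folklore] -/
theorem isUpperSet_obcnEvent (i M k : ℕ) (T₀ : ℤ) (w : ℕ) : IsUpperSet (obcnEvent i M k T₀ w) :=
  isUpperSet_preimage_frameConfig i (isUpperSet_triFrameAt _ _)

/-- **The outer corridor event is increasing.** [folklore] -/
theorem isUpperSet_ocorrEvent (i M k : ℕ) (T₀ : ℤ) (w L ε r e s a len : ℕ) (t : ℤ) (W N' : ℕ) :
    IsUpperSet (ocorrEvent i M k T₀ w L ε r e s a len t W N') :=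
  ((((isUpperSet_obcnEvent i M k T₀ w).inter (isUpperSet_ospokeEvent i M k T₀ w L ε)).inter (isUpperSet_eventAll _)).inter
    (isUpperSet_triHCross _ _ _ _)).inter (isUpperSet_triVCross _ _ _ _)

namespace Slot

variable (P : OParams) (σ : Slot)

/-- The corridor of the open arm is increasing. [folklore] -/
theorem isUpperSet_oblackCorr : IsUpperSet (σ.oblackCorr P) := isUpperSet_ocorrEvent _ _ _ _ _ _ _ _ _ _ _ _ _ _ _

/-- The corridor of the closed arm is decreasing. [folklore] -/
theorem isLowerSet_owhiteCorr : IsLowerSet (σ.owhiteCorr P) :=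
  IsUpperSet.preimage_negFlip (isUpperSet_ocorrEvent _ _ _ _ _ _ _ _ _ _ _ _ _ _ _)

end Slot

/-! ### Supports -/

/-- **The outer slot frame box** (tip's frame): `[2M + 1, 2M + 5k] × [T₀ + 1, T₀ + w + 4k]`, containing
the exterior part of the fence zone, the fence strip, the beacon and the tip box of every tip of
scale `k` with tip row in the window `[T₀, T₀ + w)`. [cite: Nolin2008, §4.2 Def. 6 (arXiv 0711.4948)] -/
def oslotFrame (M k : ℕ) (T₀ : ℤ) (w : ℕ) : Finset (Site 2) := triStripFinset (2 * (M : ℤ) + 1) (T₀ + 1) (5 * k - 1) (w + 4 * k - 1)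

/-- Membership in the outer slot frame box (`1 ≤ k`). [folklore] -/
theorem mem_oslotFrame {M k : ℕ} (hk : 1 ≤ k) {T₀ : ℤ} {w : ℕ} {v : Site 2} :
    v ∈ oslotFrame M k T₀ w ↔ 2 * (M : ℤ) + 1 ≤ v 0 ∧ v 0 ≤ 2 * (M : ℤ) + 5 * k ∧ T₀ + 1 ≤ v 1 ∧ v 1 ≤ T₀ + w + 4 * k := by
  rw [oslotFrame, ← Finset.mem_coe, coe_triStripFinset, mem_triStrip]
  have h1 : ((5 * k - 1 : ℕ) : ℤ) = 5 * k - 1 := by omega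
  have h2 : ((w + 4 * k - 1 : ℕ) : ℤ) = w + 4 * k - 1 := by omega
  rw [h1, h2]; omega

/-- **The shared support** `{n ≤ |v| ≤ 2M}` (the annulus of the arms; the trapezoids of the
protections and of the explorations lie in it). [cite: Nolin2008, §4.3 Lemma 13 (arXiv 0711.4948: Lemma 12, the set `𝒜`)] -/
def osharedFin (n M : ℕ) : Finset (Site 2) := (triBall (2 * M)).filter fun v => (n : ℤ) ≤ triNorm v

/-- Membership in the shared support. [folklore] -/
@[simp] theorem mem_osharedFin {n M : ℕ} {v : Site 2} : v ∈ osharedFin n M ↔ (n : ℤ) ≤ triNorm v ∧ triNorm v ≤ 2 * M := by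
  rw [osharedFin, Finset.mem_filter, mem_triBall_iff]; push_cast; tauto

/-- `osharedFin n M` is the annulus `triAnnSet n (2M)`. [folklore] -/
theorem coe_osharedFin (n M : ℕ) : (↑(osharedFin n M) : Set (Site 2)) = triAnnSet n (2 * M) := by
  ext v; rw [Finset.mem_coe, mem_osharedFin, mem_triAnnSet]; push_cast; tauto

/-- **The support of an outer corridor**: `frameIso i` of the slot frame box and of the spoke's box,
the sites of the arc, the approach box and the target box. [cite: Nolin2008, §4.3 Lemma 13 (arXiv 0711.4948: Lemma 12, the sets `𝒜^±`)] -/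
def ocorrFin (i M k : ℕ) (T₀ : ℤ) (w L ε r e s a len : ℕ) (t : ℤ) (W N' : ℕ) : Finset (Site 2) :=
  (oslotFrame M k T₀ w ∪ (ospokeTube M k T₀ w L ε).sites).image (frameIso i) ∪ sitesAll (arc (thinRing r e s) a len) ∪
    triStripFinset ((r : ℤ) - 2 * e) t W (N' / 64) ∪
    triStripFinset ((N' : ℤ) + 1) (t - (N' / 64 : ℕ)) (N' / 16 - 1) (2 * (N' / 64))

namespace Slot

variable (P : OParams) (σ : Slot)

/-- **The private support of the open arm of the slot.** [cite: Nolin2008, §4.3 Lemma 13 (arXiv 0711.4948: Lemma 12)] -/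
def oPfin : Finset (Site 2) :=
  ocorrFin σ.io P.M (σ.oko P) (σ.oTo P) P.w P.LB P.ε P.rB P.e P.s (σ.oaB P) P.lenB (σ.otgo P) P.WB P.N'

/-- **The private support of the closed arm of the slot** (the reflection of the support of its
corridor in the colour-exchanged picture). [cite: Nolin2008, §4.3 Lemma 13 (arXiv 0711.4948: Lemma 12)] -/
def oMfin : Finset (Site 2) :=
  (ocorrFin σ.ic' P.M (σ.okc P) (σ.oTc P) P.w P.LW P.ε P.rW P.e P.s (σ.oaW P) (σ.olenW P) (σ.otgc P) P.WW P.N').image Neg.neg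

end Slot

/-! ### The corridors are determined by their supports -/

/-- The beacon's square annulus lies in the outer slot frame box (`2 ≤ k`). [folklore] -/
theorem triSqAnnulusFinset_obcn_subset_oslotFrame {M k : ℕ} (hk : 2 ≤ k) (T₀ : ℤ) (w : ℕ) :
    (↑(triSqAnnulusFinset (obcnCentre M k T₀ w) (k / 2) (2 * (k / 2))) : Set (Site 2)) ⊆ ↑(oslotFrame M k T₀ w) := by
  intro v hv
  rw [Finset.mem_coe, mem_triSqAnnulusFinset] at hv
  rw [Finset.mem_coe, mem_oslotFrame (by omega)]
  simp only [obcnCentre, site_mk_apply_zero, site_mk_apply_one] at hv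
  omega

/-- **The outer corridor event is determined by its support** (`2 ≤ k`). [folklore] -/
theorem determinedBy_ocorrEvent {i M k : ℕ} (hk : 2 ≤ k) (T₀ : ℤ) (w L ε r e s a len : ℕ) (t : ℤ) (W N' : ℕ) :
    DeterminedBy (ocorrEvent i M k T₀ w L ε r e s a len t W N') ↑(ocorrFin i M k T₀ w L ε r e s a len t W N') := by
  unfold ocorrEvent ocorrFin otgtV
  have himg : ∀ (B : Finset (Site 2)), (↑(B.image (frameIso i)) : Set (Site 2)) = frameIso i '' ↑B := fun B => Finset.coe_image
  have d1 : DeterminedBy (obcnEvent i M k T₀ w) (frameIso i '' ↑(triSqAnnulusFinset (obcnCentre M k T₀ w) (k / 2) (2 * (k / 2)))) :=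
    determinedBy_preimage_frameConfig i (determinedBy_triFrameAt _ _)
  have d2 := determinedBy_ospokeEvent i M k T₀ w L ε
  have d3 := determinedBy_eventAll (arc (thinRing r e s) a len)
  have d4 := determinedBy_triHCross ((r : ℤ) - 2 * e) t W (N' / 64)
  have d5 := determinedBy_triVCross ((N' : ℤ) + 1) (t - (N' / 64 : ℕ)) (N' / 16 - 1) (2 * (N' / 64))
  refine ((((d1.mono ?_).inter (d2.mono ?_)).inter (d3.mono ?_)).inter (d4.mono ?_)).inter (d5.mono ?_)
  · intro v hv
    obtain ⟨u, hu, rfl⟩ := hv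
    simp only [Finset.coe_union, Set.mem_union, himg]
    exact Or.inl (Or.inl (Or.inl ⟨u, Or.inl (triSqAnnulusFinset_obcn_subset_oslotFrame hk T₀ w hu), rfl⟩))
  · intro v hv
    obtain ⟨u, hu, rfl⟩ := hv
    simp only [Finset.coe_union, Set.mem_union, himg]
    refine Or.inl (Or.inl (Or.inl ⟨u, Or.inr ?_, rfl⟩))
    rw [coe_sites]; exact hu
  · intro v hv; simp only [Finset.coe_union, Set.mem_union]; exact Or.inl (Or.inl (Or.inr hv))
  · intro v hv; simp only [Finset.coe_union, Set.mem_union]; exact Or.inl (Or.inr hv)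
  · intro v hv; simp only [Finset.coe_union, Set.mem_union]; exact Or.inr hv

namespace Slot

variable (P : OParams) (σ : Slot)

/-- **The corridor of the open arm is determined by the private support `oPfin`** (`2 ≤ k₀`). [folklore] -/
theorem determinedBy_oblackCorr (hk : 2 ≤ P.k₀) : DeterminedBy (σ.oblackCorr P) ↑(σ.oPfin P) :=
  determinedBy_ocorrEvent (k := σ.oko P) (le_trans hk (le_trapScale _ _)) _ _ _ _ _ _ _ _ _ _ _ _

/-- **The corridor of the closed arm is determined by the private support `oMfin`** (`2 ≤ k₀`). [folklore] -/
theorem determinedBy_owhiteCorr (hk : 2 ≤ P.k₀) : DeterminedBy (σ.owhiteCorr P) ↑(σ.oMfin P) := by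
  unfold owhiteCorr oMfin
  rw [Finset.coe_image]
  have h := DeterminedBy.preimage_negFlip (determinedBy_ocorrEvent (i := σ.ic') (M := P.M) (k := σ.okc P)
    (le_trans hk (le_trapScale _ _)) (σ.oTc P) P.w P.LW P.ε P.rW P.e P.s (σ.oaW P) (σ.olenW P) (σ.otgc P) P.WW P.N')
  refine h.mono ?_
  intro v hv
  exact ⟨-v, hv, neg_neg v⟩

end Slot

/-! ### The arm events are determined by the shared support and the slot frame box -/

/-- **Agreement on the shared support and on the framed slot box transports the open arm of a
slot** (valid rung, `io < 6`). [folklore] -/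
theorem Slot.oblackArm_of_agree (P : OParams) (σ : Slot) (hV : P.Valid) (hio : σ.io < 6) {ω ω' : SiteConfig (Site 2)}
    (h : ∀ v ∈ (↑(osharedFin P.n P.M) : Set (Site 2)) ∪ frameIso σ.io '' ↑(oslotFrame P.M (σ.oko P) (σ.oTo P) P.w), v ∈ ω ↔ v ∈ ω')
    (hω : ω ∈ σ.oblackArm P) : ω' ∈ σ.oblackArm P := by
  obtain ⟨hs, hk₀, hμ, hw1, hw2, -, -, -, -, -, -, -, -, -, -, -, -, -, hn, hμM, hR₀, hR₀M, -⟩ := hV.ifacts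
  obtain ⟨Fo, hmid, hj, h1, h2⟩ := hω
  have hko : Fo.k = σ.oko P := by show trapScale P.k₀ Fo.j = trapScale P.k₀ σ.jo; rw [hj]
  have hk1 : 1 ≤ Fo.k := hko ▸ one_le_trapScale (by omega) _
  have hk32 : 32 * (Fo.k : ℤ) ≤ P.μ := by rw [hko]; exact_mod_cast P.scale_le (hj ▸ Fo.j_lt)
  obtain ⟨hz0, hz1, hz2⟩ := trapO_coord Fo.z_mem
  have hnM : P.n ≤ P.M := hV.hn
  refine ⟨Fo.congr' hnM fun u hu => ?_, hmid, hj, h1, h2⟩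
  -- agreement on the frame sites
  rw [mem_frameConfig, mem_frameConfig]
  apply h
  rcases hu with (hu | hu) | hu
  · left
    rw [mem_triAnnSet] at hu
    rw [Finset.mem_coe, mem_osharedFin, triNorm_frameIso σ.io hio]
    push_cast at hu
    exact hu
  · rw [mem_trapFrameZone] at hu
    obtain ⟨hu1, hu2, hu3, hu4, hu5⟩ := hu
    rcases hu1 with hu1 | ⟨hu1, hu1'⟩
    · left
      have := trapD_subset_triAnnSet hnM (Finset.mem_coe.2 hu1)
      rw [mem_triAnnSet] at this
      rw [Finset.mem_coe, mem_osharedFin, triNorm_frameIso σ.io hio]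
      push_cast at this
      exact this
    · right
      refine ⟨u, ?_, rfl⟩
      have hn := lt_triNorm_iff_lin.1 hu1
      rw [Finset.mem_coe, mem_oslotFrame (show 1 ≤ σ.oko P from hko ▸ hk1), ← hko]
      omega
  · right
    refine ⟨u, ?_, rfl⟩
    rw [mem_triStrip] at hu
    rw [Finset.mem_coe, mem_oslotFrame (show 1 ≤ σ.oko P from hko ▸ hk1), ← hko]
    omega

/-- **The open outer arm event of a slot is determined by the shared support and the framed slot box.** [cite: Nolin2008, §4.3 Lemma 13 (arXiv 0711.4948: Lemma 12)] -/
theorem Slot.determinedBy_oblackArm (P : OParams) (σ : Slot) (hV : P.Valid) (hio : σ.io < 6) :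
    DeterminedBy (σ.oblackArm P) ((↑(osharedFin P.n P.M) : Set (Site 2)) ∪ frameIso σ.io '' ↑(oslotFrame P.M (σ.oko P) (σ.oTo P) P.w)) := by
  rw [determinedBy_iff]
  intro ω ω' hω
  have h : ∀ v ∈ (↑(osharedFin P.n P.M) : Set (Site 2)) ∪ frameIso σ.io '' ↑(oslotFrame P.M (σ.oko P) (σ.oTo P) P.w), v ∈ ω ↔ v ∈ ω' :=
    fun v hv => by
      constructor
      · intro hvω; have : v ∈ ω ∩ _ := ⟨hvω, hv⟩; rw [hω] at this; exact this.1
      · intro hvω; have : v ∈ ω' ∩ _ := ⟨hvω, hv⟩; rw [← hω] at this; exact this.1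
  exact ⟨Slot.oblackArm_of_agree P σ hV hio h, Slot.oblackArm_of_agree P σ hV hio fun v hv => (h v hv).symm⟩

/-- **Agreement on the shared support and on the framed slot box transports the closed arm of a slot.** [folklore] -/
theorem Slot.owhiteArm_of_agree (P : OParams) (σ : Slot) (hV : P.Valid) (hic : σ.ic < 6) {ω ω' : SiteConfig (Site 2)}
    (h : ∀ v ∈ (↑(osharedFin P.n P.M) : Set (Site 2)) ∪ frameIso σ.ic '' ↑(oslotFrame P.M (σ.okc P) (σ.oTc P) P.w), v ∈ ω ↔ v ∈ ω')
    (hω : ω ∈ σ.owhiteArm P) : ω' ∈ σ.owhiteArm P := by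
  obtain ⟨hs, hk₀, hμ, hw1, hw2, -, -, -, -, -, -, -, -, -, -, -, -, -, hn, hμM, hR₀, hR₀M, -⟩ := hV.ifacts
  obtain ⟨Fc, hmid, hj, h1, h2⟩ := hω
  have hkc : Fc.k = σ.okc P := by show trapScale P.k₀ Fc.j = trapScale P.k₀ σ.jc; rw [hj]
  have hk1 : 1 ≤ Fc.k := hkc ▸ one_le_trapScale (by omega) _
  have hk32 : 32 * (Fc.k : ℤ) ≤ P.μ := by rw [hkc]; exact_mod_cast P.scale_le (hj ▸ Fc.j_lt)
  obtain ⟨hz0, hz1, hz2⟩ := trapO_coord Fc.z_mem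
  have hnM : P.n ≤ P.M := hV.hn
  refine ⟨Fc.congr' hnM fun u hu => ?_, hmid, hj, h1, h2⟩
  rw [Set.mem_compl_iff, Set.mem_compl_iff, mem_frameConfig, mem_frameConfig, not_iff_not]
  apply h
  rcases hu with (hu | hu) | hu
  · left
    rw [mem_triAnnSet] at hu
    rw [Finset.mem_coe, mem_osharedFin, triNorm_frameIso σ.ic hic]
    push_cast at hu
    exact hu
  · rw [mem_trapFrameZone] at hu
    obtain ⟨hu1, hu2, hu3, hu4, hu5⟩ := hu
    rcases hu1 with hu1 | ⟨hu1, hu1'⟩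
    · left
      have := trapD_subset_triAnnSet hnM (Finset.mem_coe.2 hu1)
      rw [mem_triAnnSet] at this
      rw [Finset.mem_coe, mem_osharedFin, triNorm_frameIso σ.ic hic]
      push_cast at this
      exact this
    · right
      refine ⟨u, ?_, rfl⟩
      have hn := lt_triNorm_iff_lin.1 hu1
      rw [Finset.mem_coe, mem_oslotFrame (show 1 ≤ σ.okc P from hkc ▸ hk1), ← hkc]
      omega
  · right
    refine ⟨u, ?_, rfl⟩
    rw [mem_triStrip] at hu
    rw [Finset.mem_coe, mem_oslotFrame (show 1 ≤ σ.okc P from hkc ▸ hk1), ← hkc]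
    omega

/-- **The closed outer arm event of a slot is determined by the shared support and the framed slot box.** [cite: Nolin2008, §4.3 Lemma 13 (arXiv 0711.4948: Lemma 12)] -/
theorem Slot.determinedBy_owhiteArm (P : OParams) (σ : Slot) (hV : P.Valid) (hic : σ.ic < 6) :
    DeterminedBy (σ.owhiteArm P) ((↑(osharedFin P.n P.M) : Set (Site 2)) ∪ frameIso σ.ic '' ↑(oslotFrame P.M (σ.okc P) (σ.oTc P) P.w)) := by
  rw [determinedBy_iff]
  intro ω ω' hω
  have h : ∀ v ∈ (↑(osharedFin P.n P.M) : Set (Site 2)) ∪ frameIso σ.ic '' ↑(oslotFrame P.M (σ.okc P) (σ.oTc P) P.w), v ∈ ω ↔ v ∈ ω' :=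
    fun v hv => by
      constructor
      · intro hvω; have : v ∈ ω ∩ _ := ⟨hvω, hv⟩; rw [hω] at this; exact this.1
      · intro hvω; have : v ∈ ω' ∩ _ := ⟨hvω, hv⟩; rw [← hω] at this; exact this.1
  exact ⟨Slot.owhiteArm_of_agree P σ hV hic h, Slot.owhiteArm_of_agree P σ hV hic fun v hv => (h v hv).symm⟩


/-- **The outer corridor event has probability at least `c_F c_ρ^(B + 3)`.** Hypotheses: the
frame constant `c_F` (`exists_pos_le_real_triFrameAt`), the RSW constant `c_ρ` at aspect ratio
`ρ ≥ 4` (`0 ≤ c_ρ`), `2 ≤ k`, `1 ≤ ε` and `L + k/4 ≤ 2ρε` (spoke), `1 ≤ e` and `s + 2e ≤ 8e` (ring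
tubes), `1 ≤ N'/64` and `W ≤ ρ (N'/64)` (approach tube), `2 (N'/64) ≤ ρ (N'/16 - 1)` and
`1 ≤ N'/16 - 1` (target box), and `B` bounds the length of the arc. [cite: Nolin2008, §4.3 Prop. 12 (proof) (arXiv 0711.4948: Prop. 11)] -/
theorem real_ocorrEvent_ge {cF c : ℝ} {ρ : ℕ} (hF : ∀ (z : Site 2) (k : ℕ), 1 ≤ k → cF ≤ (triSitePercolation half).real (triFrameAt z k))
    (hrsw : ∀ q : ℕ, 1 ≤ ⌊(ρ : ℝ) * q⌋₊ → c ≤ triLRCrossingProb half ⌊(ρ : ℝ) * q⌋₊ q) (hρ : 4 ≤ ρ) (hc : 0 ≤ c)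
    {i M k : ℕ} (hk : 2 ≤ k) {T₀ : ℤ} {w L ε r e s a len B : ℕ} {t : ℤ} {W N' : ℕ}
    (hε : 1 ≤ ε) (hsp : L + k / 4 ≤ ρ * (2 * ε)) (he : 1 ≤ e) (hse : s + 2 * e ≤ 4 * (2 * e))
    (hn : 1 ≤ N' / 64) (hW : W ≤ ρ * (N' / 64)) (hV : 2 * (N' / 64) ≤ ρ * (N' / 16 - 1)) (hV' : 1 ≤ N' / 16 - 1)
    (hlen : (arc (thinRing r e s) a len).length ≤ B) :
    cF * c ^ (B + 3) ≤ (triSitePercolation half).real (ocorrEvent i M k T₀ w L ε r e s a len t W N') := by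
  have hρ1 : 1 ≤ ρ := le_trans (by norm_num) hρ
  have hc1 : c ≤ 1 := by
    have h := hrsw 1 (by
      rw [Nat.cast_one, mul_one, Nat.floor_natCast]; exact hρ1)
    exact h.trans measureReal_le_one
  -- the five events, their supports and monotonicity
  set E1 := obcnEvent i M k T₀ w with hE1
  set E2 := ospokeEvent i M k T₀ w L ε with hE2
  set E3 := eventAll (arc (thinRing r e s) a len) with hE3
  set E4 := triHCross ((r : ℤ) - 2 * e) t W (N' / 64) with hE4
  set E5 := otgtV N' t with hE5
  have d1 : DeterminedBy E1 ↑((triSqAnnulusFinset (obcnCentre M k T₀ w) (k / 2) (2 * (k / 2))).image (frameIso i)) := by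
    rw [Finset.coe_image]; exact determinedBy_preimage_frameConfig i (determinedBy_triFrameAt _ _)
  have d2 : DeterminedBy E2 ↑((ospokeTube M k T₀ w L ε).sites.image (frameIso i)) := by
    rw [Finset.coe_image, coe_sites]; exact determinedBy_ospokeEvent i M k T₀ w L ε
  have d3 : DeterminedBy E3 ↑(sitesAll (arc (thinRing r e s) a len)) := determinedBy_eventAll _
  have d4 : DeterminedBy E4 ↑(triStripFinset ((r : ℤ) - 2 * e) t W (N' / 64)) := determinedBy_triHCross _ _ _ _
  have d5 : DeterminedBy E5 ↑(triStripFinset ((N' : ℤ) + 1) (t - (N' / 64 : ℕ)) (N' / 16 - 1) (2 * (N' / 64))) :=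
    determinedBy_triVCross _ _ _ _
  have u1 : IsUpperSet E1 := isUpperSet_obcnEvent i M k T₀ w
  have u2 : IsUpperSet E2 := isUpperSet_ospokeEvent i M k T₀ w L ε
  have u3 : IsUpperSet E3 := isUpperSet_eventAll _
  have u4 : IsUpperSet E4 := isUpperSet_triHCross _ _ _ _
  have u5 : IsUpperSet E5 := isUpperSet_triVCross _ _ _ _
  -- the five probabilities
  have p1 : cF ≤ (triSitePercolation half).real E1 := by
    rw [hE1, obcnEvent, show {χ | frameConfig i χ ∈ triFrameAt (obcnCentre M k T₀ w) (k / 2)} =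
      frameConfig i ⁻¹' triFrameAt (obcnCentre M k T₀ w) (k / 2) from rfl, real_preimage_frameConfig]
    exact hF _ _ (by omega)
  have p2 : c ≤ (triSitePercolation half).real E2 := by
    rw [hE2, real_ospokeEvent]
    refine Tube.le_real_event _ hrsw hρ1 ?_
    simp only [Tube.AspectLE, ospokeTube, cond_true]
    exact ⟨hsp, by omega⟩
  have p3 : c ^ B ≤ (triSitePercolation half).real E3 := by
    refine le_trans (pow_le_pow_of_le_one hc hc1 hlen) ?_
    refine Tube.pow_le_real_eventAll hrsw hρ1 hc _ fun T hT => ?_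
    exact (aspectLE_of_mem_thinRing he hse (mem_of_mem_arc hT)).mono hρ
  have p4 : c ≤ (triSitePercolation half).real E4 := by
    rw [hE4, show triHCross ((r : ℤ) - 2 * e) t W (N' / 64) = (⟨(r : ℤ) - 2 * e, t, W, N' / 64, true⟩ : Tube).event from rfl]
    refine Tube.le_real_event _ hrsw hρ1 ?_
    simp only [Tube.AspectLE, cond_true]
    exact ⟨hW, hn⟩
  have p5 : c ≤ (triSitePercolation half).real E5 := by
    rw [hE5, show otgtV N' t = (⟨(N' : ℤ) + 1, t - (N' / 64 : ℕ), N' / 16 - 1, 2 * (N' / 64), false⟩ : Tube).event from rfl]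
    refine Tube.le_real_event _ hrsw hρ1 ?_
    simp only [Tube.AspectLE, cond_false]
    exact ⟨hV, hV'⟩
  -- Harris, four times
  have h12 := sitePercolation_harris' half d1 d2 u1 u2
  have d12 : DeterminedBy (E1 ∩ E2) ↑((triSqAnnulusFinset (obcnCentre M k T₀ w) (k / 2) (2 * (k / 2))).image (frameIso i) ∪
      (ospokeTube M k T₀ w L ε).sites.image (frameIso i)) := by
    rw [Finset.coe_union]; exact (d1.mono subset_union_left).inter (d2.mono subset_union_right)
  have h123 := sitePercolation_harris' half d12 d3 (u1.inter u2) u3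
  have d123 : DeterminedBy (E1 ∩ E2 ∩ E3) ↑(((triSqAnnulusFinset (obcnCentre M k T₀ w) (k / 2) (2 * (k / 2))).image (frameIso i) ∪
      (ospokeTube M k T₀ w L ε).sites.image (frameIso i)) ∪ sitesAll (arc (thinRing r e s) a len)) := by
    rw [Finset.coe_union]; exact (d12.mono subset_union_left).inter (d3.mono subset_union_right)
  have h1234 := sitePercolation_harris' half d123 d4 ((u1.inter u2).inter u3) u4
  have d1234 : DeterminedBy (E1 ∩ E2 ∩ E3 ∩ E4)
      ↑((((triSqAnnulusFinset (obcnCentre M k T₀ w) (k / 2) (2 * (k / 2))).image (frameIso i) ∪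
      (ospokeTube M k T₀ w L ε).sites.image (frameIso i)) ∪ sitesAll (arc (thinRing r e s) a len)) ∪
      triStripFinset ((r : ℤ) - 2 * e) t W (N' / 64)) := by
    rw [Finset.coe_union]; exact (d123.mono subset_union_left).inter (d4.mono subset_union_right)
  have h12345 := sitePercolation_harris' half d1234 d5 (((u1.inter u2).inter u3).inter u4) u5
  unfold triSitePercolation at p1 p2 p3 p4 p5 ⊢
  unfold ocorrEvent
  rw [← hE1, ← hE2, ← hE3, ← hE4, ← hE5]
  calc cF * c ^ (B + 3) = cF * c * c ^ B * c * c := by ring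
    _ ≤ (sitePercolation (Site 2) half).real E1 * (sitePercolation (Site 2) half).real E2 *
        (sitePercolation (Site 2) half).real E3 * (sitePercolation (Site 2) half).real E4 * (sitePercolation (Site 2) half).real E5 := by
      gcongr
    _ ≤ (sitePercolation (Site 2) half).real (E1 ∩ E2 ∩ E3 ∩ E4 ∩ E5) := by
      calc _ ≤ (sitePercolation (Site 2) half).real (E1 ∩ E2) * (sitePercolation (Site 2) half).real E3 *
            (sitePercolation (Site 2) half).real E4 * (sitePercolation (Site 2) half).real E5 := by gcongr
        _ ≤ (sitePercolation (Site 2) half).real (E1 ∩ E2 ∩ E3) * (sitePercolation (Site 2) half).real E4 *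
            (sitePercolation (Site 2) half).real E5 := by gcongr
        _ ≤ (sitePercolation (Site 2) half).real (E1 ∩ E2 ∩ E3 ∩ E4) * (sitePercolation (Site 2) half).real E5 := by gcongr
        _ ≤ _ := h12345

namespace Slot

/-- **The corridor of the closed arm has the same probability as the corridor read directly** (`P_{1/2}` is `negFlip`-invariant). [folklore] -/
theorem real_owhiteCorr_eq (P : OParams) (σ : Slot) :
    (triSitePercolation half).real (σ.owhiteCorr P) = (triSitePercolation half).real
      (ocorrEvent σ.ic' P.M (σ.okc P) (σ.oTc P) P.w P.LW P.ε P.rW P.e P.s (σ.oaW P) (σ.olenW P) (σ.otgc P) P.WW P.N') :=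
  triSitePercolation_real_preimage_negFlip _

/-- The length of an arc is at most the prescribed length. [folklore] -/
theorem _root_.Literature.Probability.Percolation.Tube.length_arc_le (L : List Tube) (a len : ℕ) : (arc L a len).length ≤ len := by
  unfold arc; exact List.length_take_le _ _

/-- **Both outer corridors of a valid slot have probability at least `c_F c_ρ^(12 nW + 3)`**: the
sizes of all the boxes of the two corridors meet the hypotheses of `real_ocorrEvent_ge` at an
aspect ratio `ρ ≥ 64` with `LW + μ ≤ 2ρε` (the spokes are the longest thin tubes), for a valid rung. [cite: Nolin2008, §4.3 Prop. 12 (proof) (arXiv 0711.4948: Prop. 11); §4.4 p. 12 (constants C₁, C₂)] -/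
theorem real_ocorr_ge {P : OParams} {σ : Slot} (hV : P.Valid) (hσ : σ.OInRange P) {cF c : ℝ} {ρ : ℕ}
    (hF : ∀ (z : Site 2) (k : ℕ), 1 ≤ k → cF ≤ (triSitePercolation half).real (triFrameAt z k))
    (hrsw : ∀ q : ℕ, 1 ≤ ⌊(ρ : ℝ) * q⌋₊ → c ≤ triLRCrossingProb half ⌊(ρ : ℝ) * q⌋₊ q) (hc : 0 ≤ c)
    (hρ : 64 ≤ ρ) (hρsp : P.LW + P.μ ≤ ρ * (2 * P.ε)) :
    cF * c ^ (12 * P.nW + 3) ≤ (triSitePercolation half).real (σ.oblackCorr P) ∧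
      cF * c ^ (12 * P.nW + 3) ≤ (triSitePercolation half).real (σ.owhiteCorr P) := by
  obtain ⟨hs, hw, he, hε, hk₀, hμ, hrB1, hrB2, hrW1, hrW2, hnB, hnW, hN, hWB, hWW, hn, hμM, hR₀, hR₀M, hLB, hLW⟩ := hV.facts
  have hnB1 := hV.one_le_nB
  have hnW1 := hV.one_le_nW
  have hko1 : P.k₀ ≤ σ.oko P := le_trapScale _ _
  have hkc1 : P.k₀ ≤ σ.okc P := le_trapScale _ _
  have hko2 : 32 * σ.oko P ≤ P.μ := P.scale_le hσ.hjo
  have hkc2 : 32 * σ.okc P ≤ P.μ := P.scale_le hσ.hjc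
  have hnBW : P.nB ≤ P.nW := Nat.div_le_div_right (by omega : P.rB ≤ P.rW)
  have hk1 : 1 ≤ P.k₀ := by omega
  -- common numeric hypotheses
  have hεp : 1 ≤ P.ε := by rw [hε]; omega
  have hep : 1 ≤ P.e := by rw [he]; omega
  have hse : P.s + 2 * P.e ≤ 4 * (2 * P.e) := by rw [hs, he]; omega
  have hN64 : 1 ≤ P.N' / 64 := by rw [hN]; omega
  have hV1 : 2 * (P.N' / 64) ≤ ρ * (P.N' / 16 - 1) := by
    have : 2 * (P.N' / 64) ≤ 64 * (P.N' / 16 - 1) := by rw [hN]; omega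
    exact this.trans (Nat.mul_le_mul_right _ hρ)
  have hV2 : 1 ≤ P.N' / 16 - 1 := by rw [hN]; omega
  have hWB' : P.WB ≤ ρ * (P.N' / 64) := by
    have : P.WB ≤ 64 * (P.N' / 64) := by rw [hN] at hWB ⊢; omega
    exact this.trans (Nat.mul_le_mul_right _ hρ)
  have hWW' : P.WW ≤ ρ * (P.N' / 64) := by
    have : P.WW ≤ 64 * (P.N' / 64) := by rw [hN] at hWW ⊢; omega
    exact this.trans (Nat.mul_le_mul_right _ hρ)
  have hspB : P.LB + σ.oko P / 4 ≤ ρ * (2 * P.ε) := by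
    have : P.LB + σ.oko P / 4 ≤ P.LW + P.μ := by rw [hLB, hLW]; omega
    exact this.trans hρsp
  have hspW : P.LW + σ.okc P / 4 ≤ ρ * (2 * P.ε) := by
    have : P.LW + σ.okc P / 4 ≤ P.LW + P.μ := by omega
    exact this.trans hρsp
  have hlenB : (arc (thinRing P.rB P.e P.s) (σ.oaB P) P.lenB).length ≤ 12 * P.nW :=
    (length_arc_le _ _ _).trans (by unfold OParams.lenB; omega)
  have hlenW : (arc (thinRing P.rW P.e P.s) (σ.oaW P) (σ.olenW P)).length ≤ 12 * P.nW :=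
    (length_arc_le _ _ _).trans (by unfold Slot.olenW; omega)
  have hρ4 : 4 ≤ ρ := le_trans (by norm_num) hρ
  constructor
  · exact real_ocorrEvent_ge hF hrsw hρ4 hc (by omega) hεp hspB hep hse hN64 hWB' hV1 hV2 hlenB
  · rw [real_owhiteCorr_eq]
    exact real_ocorrEvent_ge hF hrsw hρ4 hc (by omega) hεp hspW hep hse hN64 hWW' hV1 hV2 hlenW

end Slot

end Literature.Probability.Percolation
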